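import Summits.FinalStateConjecture.FinalStateConjecture.Theorems.ExactKerrEndsSettlingAlongCensoredKerrEndsGaugedFamilyPrep
import Summits.FinalStateConjecture.FinalStateConjecture.Theorems.ExactKerrEndsSettlingAlongCensoredKerrEndsFromSummit
import Literature.Geometry.Lorentzian.TameBreathingCurve
import Literature.Geometry.Lorentzian.TameGenericityLocalWindowImmersed
import Literature.Geometry.Lorentzian.TameGenericityDiagonal
import HarnessLib

/-!
# Crux `SettlingAlongCensoredKerrEnds` (stmt-FinalStateConjecture-18520), line `wall-cone-sections`,
# stub GU `stub_gaugeBorneUpgrade` — the GAUGED FAMILY of a tame curve (file 2 of 3)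

For breathing data `B : e.BreathingData z₀ r` far out on the end `e` and a curve
`H : ℝ¹ → InitialDataSet (𝓡 3) X`, the GAUGED FAMILY is

  `F' c := E_{c₀}(H (ρ c)) = (breathe (σ c₀))^* (H (ρ c))`,  `ρ c := (c₀)² e₀`,  `c₀ = c 0`,

the breathing deformation (`AFEnd.breatheFamily`, a pull-back along a compactly supported
diffeomorphism of `X`) of the QUADRATICALLY REPARAMETRISED curve `c ↦ H ((c₀)² e₀)` (file 1,
`…GaugedFamilyPrep.lean`). Written without a definition (the family is the displayed expression).
Everything below is proved from landed Literature technology; no named fact is used.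

* `gauged_zero` — through `H 0` (`breatheFamily_zero`); `isSmoothDataFamily_gauged` — jointly smooth
  (`AFEnd.contMDiff_breatheFamily_family_h/k`: breathing of a smooth FAMILY read through the smooth
  parameter maps `pr = ρ`, `τ = proj₀`);
* `gauged_agree_far`, `hCoeff_gauged_eq`, `kCoeff_gauged_eq`, `isStronglyAsymptoticallyFlatDR_gauged` —
  the members agree with `H (ρ c)` on the far region `far (‖z₀‖ + r)`, so their chart components
  agree beyond `‖z₀‖ + r` and they are DR-flat with the same masses;
* `tendsto_wDist_gauged` — `wDist (F' c) (H (ρ c)) → 0` on every collared end: the differences of the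
  chart components are jointly smooth in `(c, z)`, vanish at `c = 0` and beyond `‖z₀‖ + r`, hence are
  `O(‖c‖)` in weighted `C² × C¹` on a compact annulus;
* `isTameDataFamily_restrict_gauged` — the gauged family of a TAME curve is TAME on every collared end
  (`IsTameDataFamily.of_wDist_tendsto` riding the tame curve `H ∘ ρ`);
* `isImmersedAtZero_gauged` — IMMERSED at `0`: the centre marker
  `c ↦ (1 + σ c₀)² · h_{H (ρ c)}(x₀)(v₀, v₀)` (`breatheFamily_h_inner_center`) has derivative
  `2 σ'(0) h_{H 0}(x₀)(v₀, v₀) ≠ 0` at `0` — the `H`-factor is `φ ((c₀)²)` with `φ` smooth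
  (`contDiff_h_inner_line`), so its first variation vanishes: this is what the quadratic
  reparametrisation is for;
* `gauged_mem_admissibleVacuumData`, `settled_gauged` — admissible members
  (`AFEnd.breatheCurve_mem_admissibleVacuumData`), and settled members off `0` (`Settled` is invariant
  under re-indexing by diffeomorphisms, `settled_breatheFamily`; `ρ c ≠ 0` for `c ≠ 0`).

References: Christodoulou, CQG 16 (1999) A23, p. A24 (genericity by lines in a fixed space of data);
Lee, *Introduction to Smooth Manifolds* (2013), Prop. 2.25; Bartnik–Isenberg 2004, §2 (diffeomorphism
covariance of the constraints); Choquet-Bruhat–Geroch, CMP 14 (1969), p. 330 (covariance of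
developments); Dafermos–Rodnianski, arXiv:0811.0354, App. B.2.3 (the weights); Dieudonné 1960, (8.12.6).
-/

-- the doubled `FinalStateConjecture.FinalStateConjecture` path component trips dupNamespace
set_option linter.dupNamespace false

noncomputable section

open Set Function Filter Metric TopologicalSpace Bundle
open scoped Manifold ContDiff Topology ENNReal

namespace Summit.FinalStateConjecture.FinalStateConjecture.Theorems.ExactKerrEnds

open Literature.Geometry.Lorentzian
open Summit.FinalStateConjecture (HasCompleteNullInfinity exteriorOf RaysStayInClosure HasExhaustiveCharts
  IsFutureOriented)

namespace GaugeBorneUpgrade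

variable {X : Type} [TopologicalSpace X] [ChartedSpace E3 X] [IsManifold (𝓡 3) ∞ X]

/-! ### §3 The gauged family `F' c = (breathe (σ (c 0)))^* (H ((c 0)² e₀))` -/

section Gauged

variable [T2Space X] {e : AFEnd X} {z₀ : E3} {r : ℝ} (B : AFEnd.BreathingData e z₀ r)
  (H : EuclideanSpace ℝ (Fin 1) → InitialDataSet (𝓡 3) X)

/-- **The gauged family passes through `H 0`** (`ρ 0 = 0`, `σ 0 = 0`, `breathe 0 = id`). [folklore] -/
theorem gauged_zero :
    AFEnd.breatheFamily B (H (EuclideanSpace.single 0 (((0 : EuclideanSpace ℝ (Fin 1)) 0) ^ 2)))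
        ((0 : EuclideanSpace ℝ (Fin 1)) 0) = H 0 := by
  rw [quad_zero]
  exact AFEnd.breatheFamily_zero B (H 0)

/-- **The gauged family is jointly smooth** (breathing of the smooth family `H` read through the smooth
parameter maps `pr = ρ`, `τ = proj₀`: `AFEnd.contMDiff_breatheFamily_family_h/k`).
[cite: LeeSmoothManifolds2013, Prop. 2.25] -/
theorem isSmoothDataFamily_gauged (hH : InitialDataSet.IsSmoothDataFamily 1 H) :
    InitialDataSet.IsSmoothDataFamily 1 (fun c : EuclideanSpace ℝ (Fin 1) ↦
      AFEnd.breatheFamily B (H (EuclideanSpace.single 0 ((c 0) ^ 2))) (c 0)) := by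
  have hτ : ContDiff ℝ ∞ (fun c : EuclideanSpace ℝ (Fin 1) ↦ c 0) :=
    contDiff_piLp_apply (𝕜 := ℝ) (n := ∞) (p := 2) (E := fun _ : Fin 1 => ℝ) (i := 0)
  exact ⟨AFEnd.contMDiff_breatheFamily_family_h B
      (pr := fun c : EuclideanSpace ℝ (Fin 1) ↦
        (EuclideanSpace.single 0 ((c 0) ^ 2) : EuclideanSpace ℝ (Fin 1)))
      (τ := fun c : EuclideanSpace ℝ (Fin 1) ↦ c 0) (G := H) contDiff_quad hτ hH.1,
    AFEnd.contMDiff_breatheFamily_family_k B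
      (pr := fun c : EuclideanSpace ℝ (Fin 1) ↦
        (EuclideanSpace.single 0 ((c 0) ^ 2) : EuclideanSpace ℝ (Fin 1)))
      (τ := fun c : EuclideanSpace ℝ (Fin 1) ↦ c 0) (G := H) contDiff_quad hτ hH.2⟩

/-- **The base member of the gauged family IS `H (ρ 0)`** (the form in which the two families are
compared: `σ 0 = 0`, `breathe 0 = id`). [folklore] -/
theorem gauged_zero' :
    AFEnd.breatheFamily B (H (EuclideanSpace.single 0 (((0 : EuclideanSpace ℝ (Fin 1)) 0) ^ 2)))
        ((0 : EuclideanSpace ℝ (Fin 1)) 0) =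
      H (EuclideanSpace.single 0 (((0 : EuclideanSpace ℝ (Fin 1)) 0) ^ 2)) := by
  have h00 : ((0 : EuclideanSpace ℝ (Fin 1)) 0 : ℝ) = 0 := rfl
  simp only [h00]
  exact AFEnd.breatheFamily_zero B _

/-- **The gauged members agree with `H (ρ c)` on the far region `far (‖z₀‖ + r)`** (the breathing
diffeomorphism is the identity off the core). [cite: Bartnik1986, §1] -/
theorem gauged_agree_far (c : EuclideanSpace ℝ (Fin 1)) {q : X} (hq : q ∈ e.far (‖z₀‖ + r)) :
    (AFEnd.breatheFamily B (H (EuclideanSpace.single 0 ((c 0) ^ 2))) (c 0)).h.inner q =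
        (H (EuclideanSpace.single 0 ((c 0) ^ 2))).h.inner q ∧
      (AFEnd.breatheFamily B (H (EuclideanSpace.single 0 ((c 0) ^ 2))) (c 0)).k q =
        (H (EuclideanSpace.single 0 ((c 0) ^ 2))).k q :=
  AFEnd.breatheFamily_eq_of_mem_far B _ (c 0) le_rfl hq

include B in
omit [IsManifold (𝓡 3) ∞ X] [T2Space X] in
/-- `max (‖z₀‖ + r) e.R = ‖z₀‖ + r` (the breathing ball lies in the exterior region). [folklore] -/
theorem max_far_radius_lt {z : E3} (hz : ‖z₀‖ + r < ‖z‖) : max (‖z₀‖ + r) e.R < ‖z‖ := by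
  have hR₀ : e.R < ‖z₀‖ + r := by linarith [B.R_lt_norm_center, B.r_pos]
  rw [max_eq_left hR₀.le]
  exact hz

/-- **The chart components of `h` of the gauged members agree with those of `H (ρ c)` beyond
`‖z₀‖ + r`.** [cite: Bartnik1986, (1.3)] -/
theorem hCoeff_gauged_eq (c : EuclideanSpace ℝ (Fin 1)) {z : E3} (hz : ‖z₀‖ + r < ‖z‖) :
    AFEnd.hCoeff e (AFEnd.breatheFamily B (H (EuclideanSpace.single 0 ((c 0) ^ 2))) (c 0)) z =
      AFEnd.hCoeff e (H (EuclideanSpace.single 0 ((c 0) ^ 2))) z :=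
  e.hCoeff_eq_of_agree_far (fun _ hq ↦ (gauged_agree_far B H c hq).1) (max_far_radius_lt B hz)

/-- **The chart components of `k` of the gauged members agree with those of `H (ρ c)` beyond
`‖z₀‖ + r`.** [cite: ChristodoulouKlainerman1993, (1.0.9)] -/
theorem kCoeff_gauged_eq (c : EuclideanSpace ℝ (Fin 1)) {z : E3} (hz : ‖z₀‖ + r < ‖z‖) :
    AFEnd.kCoeff e (AFEnd.breatheFamily B (H (EuclideanSpace.single 0 ((c 0) ^ 2))) (c 0)) z =
      AFEnd.kCoeff e (H (EuclideanSpace.single 0 ((c 0) ^ 2))) z :=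
  e.kCoeff_eq_of_agree_far (fun _ hq ↦ (gauged_agree_far B H c hq).2) (max_far_radius_lt B hz)

/-- **The gauged members are DR-flat with the masses of `H (ρ c)`** (they agree on a far region,
`IsStronglyAsymptoticallyFlatDR.congr_of_eqOn_far`). [cite: DafermosRodnianski2013, App. B.2.3] -/
theorem isStronglyAsymptoticallyFlatDR_gauged {c : EuclideanSpace ℝ (Fin 1)} {M : ℝ}
    (h : e.IsStronglyAsymptoticallyFlatDR (H (EuclideanSpace.single 0 ((c 0) ^ 2))) M) :
    e.IsStronglyAsymptoticallyFlatDR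
      (AFEnd.breatheFamily B (H (EuclideanSpace.single 0 ((c 0) ^ 2))) (c 0)) M :=
  h.congr_of_eqOn_far (fun _ hq ↦ (gauged_agree_far B H c hq).1)
    (fun _ hq ↦ (gauged_agree_far B H c hq).2)

-- the operator norm on `E3 →L[ℝ] E3 →L[ℝ] ℝ` is slow to synthesize through `PiLp` (as in
-- `AFEndBreathingFamily.lean`); `sub_self` on that space needs it
set_option synthInstance.maxHeartbeats 100000 in
/-- **The weighted distance of the gauged member to `H (ρ c)` on a collared end tends to `0` with
`c`.** The differences of the chart components are jointly smooth in `(c, z)` on the exterior region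
(`AFEnd.contDiffAt_hCoeff_family` / `contDiffAt_kCoeff_family` for the two smooth families), vanish
beyond `‖z₀‖ + r` and identically at `c = 0` (the base member IS `H (ρ 0)`), so their weighted
`C² × C¹` suprema over `{R₁ < ‖x‖}` are `O(‖c‖)` on a compact annulus
(`tendsto_iSup_weight_iteratedFDeriv_sub_nhds_zero`); read on the collar by `AFEnd.wDist_restrict_eq`.
[cite: DafermosRodnianski2013, App. B.2.3] -/
theorem tendsto_wDist_gauged (hH : InitialDataSet.IsSmoothDataFamily 1 H) {R₁ : ℝ} (hR₁ : e.R < R₁) :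
    Tendsto (fun c : EuclideanSpace ℝ (Fin 1) ↦ (e.restrict hR₁.le).wDist
      (AFEnd.breatheFamily B (H (EuclideanSpace.single 0 ((c 0) ^ 2))) (c 0))
      (H (EuclideanSpace.single 0 ((c 0) ^ 2)))) (𝓝 0) (𝓝 0) := by
  -- `t - t = 0` on the space of bilinear forms, synthesized once
  have hss : ∀ t : E3 →L[ℝ] E3 →L[ℝ] ℝ, t - t = 0 := fun t ↦ sub_self t
  have hs := isSmoothDataFamily_gauged B H hH
  have hsρ : InitialDataSet.IsSmoothDataFamily 1 (fun c : EuclideanSpace ℝ (Fin 1) ↦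
      H (EuclideanSpace.single 0 ((c 0) ^ 2))) := hH.comp_contDiff contDiff_quad
  -- the two difference families: jointly smooth on the exterior region
  have hΦs : ∀ (c : EuclideanSpace ℝ (Fin 1)) (z : E3), e.R < ‖z‖ →
      ContDiffAt ℝ ∞ (uncurry fun (c : EuclideanSpace ℝ (Fin 1)) (z : E3) ↦
        AFEnd.hCoeff e (AFEnd.breatheFamily B (H (EuclideanSpace.single 0 ((c 0) ^ 2))) (c 0)) z -
          AFEnd.hCoeff e (H (EuclideanSpace.single 0 ((c 0) ^ 2))) z) (c, z) := fun c z hz ↦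
    contDiffAt_uncurry_sub (AFEnd.contDiffAt_hCoeff_family hs.1 c hz)
      (AFEnd.contDiffAt_hCoeff_family hsρ.1 c hz)
  have hΨs : ∀ (c : EuclideanSpace ℝ (Fin 1)) (z : E3), e.R < ‖z‖ →
      ContDiffAt ℝ ∞ (uncurry fun (c : EuclideanSpace ℝ (Fin 1)) (z : E3) ↦
        AFEnd.kCoeff e (AFEnd.breatheFamily B (H (EuclideanSpace.single 0 ((c 0) ^ 2))) (c 0)) z -
          AFEnd.kCoeff e (H (EuclideanSpace.single 0 ((c 0) ^ 2))) z) (c, z) := fun c z hz ↦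
    contDiffAt_uncurry_sub (AFEnd.contDiffAt_kCoeff_family hs.2 c hz)
      (AFEnd.contDiffAt_kCoeff_family hsρ.2 c hz)
  -- … and vanishing beyond `‖z₀‖ + r`
  have hΦfar : ∀ (c : EuclideanSpace ℝ (Fin 1)) (z : E3), ‖z₀‖ + r < ‖z‖ →
      AFEnd.hCoeff e (AFEnd.breatheFamily B (H (EuclideanSpace.single 0 ((c 0) ^ 2))) (c 0)) z -
          AFEnd.hCoeff e (H (EuclideanSpace.single 0 ((c 0) ^ 2))) z =
        AFEnd.hCoeff e (AFEnd.breatheFamily B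
            (H (EuclideanSpace.single 0 (((0 : EuclideanSpace ℝ (Fin 1)) 0) ^ 2)))
            ((0 : EuclideanSpace ℝ (Fin 1)) 0)) z -
          AFEnd.hCoeff e (H (EuclideanSpace.single 0 (((0 : EuclideanSpace ℝ (Fin 1)) 0) ^ 2))) z := by
    intro c z hz
    rw [hCoeff_gauged_eq B H c hz, hCoeff_gauged_eq B H 0 hz, hss, hss]
  have hΨfar : ∀ (c : EuclideanSpace ℝ (Fin 1)) (z : E3), ‖z₀‖ + r < ‖z‖ →
      AFEnd.kCoeff e (AFEnd.breatheFamily B (H (EuclideanSpace.single 0 ((c 0) ^ 2))) (c 0)) z -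
          AFEnd.kCoeff e (H (EuclideanSpace.single 0 ((c 0) ^ 2))) z =
        AFEnd.kCoeff e (AFEnd.breatheFamily B
            (H (EuclideanSpace.single 0 (((0 : EuclideanSpace ℝ (Fin 1)) 0) ^ 2)))
            ((0 : EuclideanSpace ℝ (Fin 1)) 0)) z -
          AFEnd.kCoeff e (H (EuclideanSpace.single 0 (((0 : EuclideanSpace ℝ (Fin 1)) 0) ^ 2))) z := by
    intro c z hz
    rw [kCoeff_gauged_eq B H c hz, kCoeff_gauged_eq B H 0 hz, hss, hss]
  -- at `c = 0` the differences vanish identically (the base member IS `H (ρ 0)`)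
  have hbase := gauged_zero' B H
  have hΦ0 : ∀ z : E3,
      AFEnd.hCoeff e (AFEnd.breatheFamily B
          (H (EuclideanSpace.single 0 (((0 : EuclideanSpace ℝ (Fin 1)) 0) ^ 2)))
          ((0 : EuclideanSpace ℝ (Fin 1)) 0)) z -
        AFEnd.hCoeff e (H (EuclideanSpace.single 0 (((0 : EuclideanSpace ℝ (Fin 1)) 0) ^ 2))) z = 0 := by
    intro z
    rw [hbase]
    exact hss _
  have hΨ0 : ∀ z : E3,
      AFEnd.kCoeff e (AFEnd.breatheFamily B
          (H (EuclideanSpace.single 0 (((0 : EuclideanSpace ℝ (Fin 1)) 0) ^ 2)))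
          ((0 : EuclideanSpace ℝ (Fin 1)) 0)) z -
        AFEnd.kCoeff e (H (EuclideanSpace.single 0 (((0 : EuclideanSpace ℝ (Fin 1)) 0) ^ 2))) z = 0 := by
    intro z
    rw [hbase]
    exact hss _
  have hA := tendsto_iSup_weight_iteratedFDeriv_nhds_zero_of_base_zero
    (Φ := fun (c : EuclideanSpace ℝ (Fin 1)) (z : E3) ↦
      AFEnd.hCoeff e (AFEnd.breatheFamily B (H (EuclideanSpace.single 0 ((c 0) ^ 2))) (c 0)) z -
        AFEnd.hCoeff e (H (EuclideanSpace.single 0 ((c 0) ^ 2))) z) hR₁ hΦs hΦfar hΦ0 2 1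
  have hB' := tendsto_iSup_weight_iteratedFDeriv_nhds_zero_of_base_zero
    (Φ := fun (c : EuclideanSpace ℝ (Fin 1)) (z : E3) ↦
      AFEnd.kCoeff e (AFEnd.breatheFamily B (H (EuclideanSpace.single 0 ((c 0) ^ 2))) (c 0)) z -
        AFEnd.kCoeff e (H (EuclideanSpace.single 0 ((c 0) ^ 2))) z) hR₁ hΨs hΨfar hΨ0 1 2
  have hsum := hA.add hB'
  rw [add_zero] at hsum
  -- these are the integrands of the weighted distance on the collar
  refine hsum.congr' (Eventually.of_forall fun c ↦ ?_)
  exact (e.wDist_restrict_eq hR₁.le _ _).symm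

/-- **The gauged family is TAME on every collared end.** Ride the tame curve `c ↦ H (ρ c)`
(`IsTameDataFamily.comp_contDiff`, restricted to the collar, `isTameDataFamily_restrict`): the gauged
family is jointly smooth, passes through the same base member, its members are DR-flat with the same
(continuous) masses (`isStronglyAsymptoticallyFlatDR_gauged`), and `wDist (F' c) (H (ρ c)) → 0`
(`tendsto_wDist_gauged`); conclude by `IsTameDataFamily.of_wDist_tendsto`.
[cite: Christodoulou1999, p. A24] -/
theorem isTameDataFamily_restrict_gauged (hH : InitialDataSet.IsTameDataFamily e 1 H) {R₁ : ℝ}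
    (hR₁ : e.R < R₁) :
    InitialDataSet.IsTameDataFamily (e.restrict hR₁.le) 1 (fun c : EuclideanSpace ℝ (Fin 1) ↦
      AFEnd.breatheFamily B (H (EuclideanSpace.single 0 ((c 0) ^ 2))) (c 0)) := by
  -- the reparametrised base curve and its tameness on the collar
  have hHρ : InitialDataSet.IsTameDataFamily e 1 (fun c : EuclideanSpace ℝ (Fin 1) ↦
      H (EuclideanSpace.single 0 ((c 0) ^ 2))) := hH.comp_contDiff contDiff_quad quad_zero
  have hHρ' := isTameDataFamily_restrict hHρ hR₁
  obtain ⟨-, -, ⟨M, hM, hSAF⟩, -⟩ := hHρ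
  -- base member
  have h0 : (fun c : EuclideanSpace ℝ (Fin 1) ↦
      AFEnd.breatheFamily B (H (EuclideanSpace.single 0 ((c 0) ^ 2))) (c 0)) 0 =
        (fun c : EuclideanSpace ℝ (Fin 1) ↦ H (EuclideanSpace.single 0 ((c 0) ^ 2))) 0 :=
    gauged_zero' B H
  -- decay of the members on the collar, masses `M (ρ c)`
  have hDR : ∀ c : EuclideanSpace ℝ (Fin 1), (e.restrict hR₁.le).IsStronglyAsymptoticallyFlatDR
      (AFEnd.breatheFamily B (H (EuclideanSpace.single 0 ((c 0) ^ 2))) (c 0)) (M c) := fun c ↦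
    (e.isStronglyAsymptoticallyFlatDR_restrict_iff hR₁.le _ _).2
      (isStronglyAsymptoticallyFlatDR_gauged B H (hSAF c))
  exact hHρ'.of_wDist_tendsto (isSmoothDataFamily_gauged B H hH.1) h0 hM hDR
    (tendsto_wDist_gauged B H hH.1 hR₁)

/-- **The gauged family is IMMERSED at the base parameter.** At the centre `x₀ = Φₑ z₀` and for
`v₀ = e₀`, the marker `c ↦ h_{F' c}(x₀)(v₀, v₀) = (1 + σ c₀)² · h_{H (ρ c)}(x₀)(v₀, v₀)`
(`breatheFamily_h_inner_center`) is `g c₀` with `g t = (1 + σ t)² · φ (t²)`, `φ` smooth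
(`contDiff_h_inner_line`); so `g' 0 = 2 σ'(0) φ 0 > 0` (`σ'(0) = s₀/π > 0`, `φ 0 = h_{H 0}(x₀)(v₀, v₀) > 0`:
the first variation of the `H`-factor is killed by the quadratic reparametrisation), and the
`v`-derivative at `0` is `g' 0 · v₀ ≠ 0` for `v ≠ 0`. [cite: Christodoulou1999, p. A24] -/
theorem isImmersedAtZero_gauged (hH : InitialDataSet.IsSmoothDataFamily 1 H) :
    InitialDataSet.IsImmersedAtZero 1 (fun c : EuclideanSpace ℝ (Fin 1) ↦
      AFEnd.breatheFamily B (H (EuclideanSpace.single 0 ((c 0) ^ 2))) (c 0)) := by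
  intro v hv
  -- the direction has a non-zero coordinate
  have hv0 : v 0 ≠ 0 := by
    intro h
    apply hv
    ext i
    fin_cases i
    simpa using h
  -- the centre, a non-zero tangent vector, and the smooth positive factor `φ`
  set x₀ : X := e.dataChartExt z₀ with hx₀
  set v₀ : TangentSpace (𝓡 3) x₀ := (EuclideanSpace.single (0 : Fin 3) (1 : ℝ) : E3) with hv₀
  have hv₀ne : v₀ ≠ 0 := by
    have h : (EuclideanSpace.single (0 : Fin 3) (1 : ℝ) : E3) ≠ 0 := by
      rw [← norm_ne_zero_iff, PiLp.norm_single, norm_one]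
      exact one_ne_zero
    exact h
  set φ : ℝ → ℝ := fun s ↦ (H (EuclideanSpace.single 0 s)).h.inner x₀ v₀ v₀ with hφ
  have hφs : ContDiff ℝ ∞ φ := InitialDataSet.contDiff_h_inner_line hH x₀ v₀ v₀
  have hφ0 : 0 < φ 0 := (H (EuclideanSpace.single 0 0)).h.pos x₀ v₀ hv₀ne
  refine ⟨x₀, v₀, v₀, Or.inl ?_⟩
  -- the marker along the family is `g (c 0)` with `g t = (1 + σ t)² · φ (t²)`
  have hline : (fun c : EuclideanSpace ℝ (Fin 1) ↦
      (AFEnd.breatheFamily B (H (EuclideanSpace.single 0 ((c 0) ^ 2))) (c 0)).h.inner x₀ v₀ v₀) =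
        (fun t : ℝ ↦ (1 + AFEnd.squash B t) ^ 2 * φ (t ^ 2)) ∘ fun c ↦ c 0 := by
    funext c
    simp only [hφ, Function.comp_apply]
    exact AFEnd.breatheFamily_h_inner_center B _ (c 0) v₀ v₀
  -- derivative of `g` at `0`
  have hsq : HasDerivAt (AFEnd.squash B) (AFEnd.breatheScale B / Real.pi) 0 := by
    have h := (Real.hasDerivAt_arctan 0).const_mul (AFEnd.breatheScale B / Real.pi)
    simp only [ne_eq, OfNat.ofNat_ne_zero, not_false_eq_true, zero_pow, add_zero, div_one,
      mul_one] at h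
    exact h
  have hg1 : HasDerivAt (fun t : ℝ ↦ (1 + AFEnd.squash B t) ^ 2)
      ((2 : ℕ) * (1 + AFEnd.squash B 0) ^ (2 - 1) * (AFEnd.breatheScale B / Real.pi)) 0 :=
    (hsq.const_add 1).pow 2
  have hφd : HasDerivAt φ (deriv φ ((0 : ℝ) ^ 2)) ((0 : ℝ) ^ 2) :=
    ((hφs.differentiable (by simp)) _).hasDerivAt
  have hpow : HasDerivAt (fun t : ℝ ↦ t ^ 2) ((2 : ℕ) * (0 : ℝ) ^ (2 - 1)) 0 := hasDerivAt_pow 2 0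
  have hg2 : HasDerivAt (fun t : ℝ ↦ φ (t ^ 2)) (deriv φ ((0 : ℝ) ^ 2) * ((2 : ℕ) * (0 : ℝ) ^ (2 - 1))) 0 :=
    HasDerivAt.comp_of_eq (x := (0 : ℝ)) (hh₂ := hφd) (hh := hpow) (hy := rfl)
  have hgd : HasDerivAt (fun t : ℝ ↦ (1 + AFEnd.squash B t) ^ 2 * φ (t ^ 2))
      ((2 : ℕ) * (1 + AFEnd.squash B 0) ^ (2 - 1) * (AFEnd.breatheScale B / Real.pi) * φ (0 ^ 2) +
        (1 + AFEnd.squash B 0) ^ 2 * (deriv φ ((0 : ℝ) ^ 2) * ((2 : ℕ) * (0 : ℝ) ^ (2 - 1))))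
      ((fun c : EuclideanSpace ℝ (Fin 1) ↦ c 0) 0) := by
    have : ((fun c : EuclideanSpace ℝ (Fin 1) ↦ c 0) 0) = 0 := rfl
    rw [this]
    exact hg1.fun_mul hg2
  have hproj : HasFDerivAt (𝕜 := ℝ) (fun c : EuclideanSpace ℝ (Fin 1) ↦ c 0)
      (PiLp.proj (𝕜 := ℝ) 2 (fun _ : Fin 1 ↦ ℝ) 0) 0 :=
    PiLp.hasFDerivAt_apply 2 (0 : EuclideanSpace ℝ (Fin 1)) 0
  have hcomp := hgd.comp_hasFDerivAt (0 : EuclideanSpace ℝ (Fin 1)) hproj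
  rw [hline, hcomp.fderiv]
  simp only [FunLike.coe_smul, Pi.smul_apply, PiLp.proj_apply, AFEnd.squash_zero,
    smul_eq_mul]
  have hs₀ := (AFEnd.breatheScale_spec B).1
  refine mul_ne_zero ?_ hv0
  have hval : ((2 : ℕ) : ℝ) * (1 + 0) ^ (2 - 1) * (AFEnd.breatheScale B / Real.pi) * φ (0 ^ 2) +
      (1 + 0) ^ 2 * (deriv φ ((0 : ℝ) ^ 2) * ((2 : ℕ) * (0 : ℝ) ^ (2 - 1))) =
        2 * (AFEnd.breatheScale B / Real.pi) * φ 0 := by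
    norm_num
  rw [hval]
  positivity

/-- **The gauged members of a curve of admissible data are admissible** (breathing of the admissible
datum `H (ρ c)`: `AFEnd.breatheCurve_mem_admissibleVacuumData`). [cite: BartnikIsenberg2004, §2] -/
theorem gauged_mem_admissibleVacuumData [SecondCountableTopology X] [ConnectedSpace X]
    (hadm : ∀ c, H c ∈ admissibleVacuumData X) (c : EuclideanSpace ℝ (Fin 1)) :
    AFEnd.breatheFamily B (H (EuclideanSpace.single 0 ((c 0) ^ 2))) (c 0) ∈ admissibleVacuumData X :=
  AFEnd.breatheCurve_mem_admissibleVacuumData B _ (hadm _) c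

/-- **The gauged members off `0` are settled when the members of `H` off `0` are** (`ρ c ≠ 0` for
`c ≠ 0`, and `Settled` passes along the breathing diffeomorphism, `settled_breatheFamily`).
[cite: ChoquetBruhatGeroch1969CMP, p. 330] -/
theorem settled_gauged [ConnectedSpace X]
    (hgood : ∀ c ≠ 0, ∀ 𝒟 : VacuumCauchyDevelopment (H c), 𝒟.IsMaximal →
      HasCompleteNullInfinity 𝒟.toCauchyDevelopment ∧
        ∃ (O : Set 𝒟.carrier) (dd : FinalStateDecomposition 𝒟.toSpacetime O 2),
          (∀ i, Kerr.IsSubextremal (dd.mass i) (dd.spin i)) ∧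
            O = exteriorOf 𝒟.toCauchyDevelopment dd.charted ∧
              RaysStayInClosure 𝒟.toCauchyDevelopment O ∧ HasExhaustiveCharts dd ∧
                IsFutureOriented dd)
    (c : EuclideanSpace ℝ (Fin 1)) (hc : c ≠ 0) :
    ∀ 𝒟 : VacuumCauchyDevelopment
        (AFEnd.breatheFamily B (H (EuclideanSpace.single 0 ((c 0) ^ 2))) (c 0)), 𝒟.IsMaximal →
      HasCompleteNullInfinity 𝒟.toCauchyDevelopment ∧
        ∃ (O : Set 𝒟.carrier) (dd : FinalStateDecomposition 𝒟.toSpacetime O 2),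
          (∀ i, Kerr.IsSubextremal (dd.mass i) (dd.spin i)) ∧
            O = exteriorOf 𝒟.toCauchyDevelopment dd.charted ∧
              RaysStayInClosure 𝒟.toCauchyDevelopment O ∧ HasExhaustiveCharts dd ∧
                IsFutureOriented dd :=
  settled_breatheFamily B _ (c 0) (hgood _ (quad_ne_zero hc))

end Gauged

end GaugeBorneUpgrade

/-- **Registered sub-goal `stub_isTameDataFamily_gaugedFamily` of the crux item
(stmt-FinalStateConjecture-18520) — THE GAUGED FAMILY OF A TAME CURVE IS TAME ON THE COLLAR AND IMMERSED
AT `0`** (closed form of `GaugeBorneUpgrade.isTameDataFamily_restrict_gauged` and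
`GaugeBorneUpgrade.isImmersedAtZero_gauged`: the two analytic inputs of stub GU).
[cite: Christodoulou1999, p. A24] -/
theorem stub_isTameDataFamily_gaugedFamily : ∀ (X : Type) [TopologicalSpace X] [ChartedSpace E3 X] [IsManifold (𝓡 3) ∞ X] [T2Space X] (e : AFEnd X) (z₀ : E3) (r : ℝ) (B : AFEnd.BreathingData e z₀ r) (H : EuclideanSpace ℝ (Fin 1) → InitialDataSet (𝓡 3) X) (R₁ : ℝ) (hR₁ : e.R < R₁), InitialDataSet.IsTameDataFamily e 1 H → InitialDataSet.IsTameDataFamily (e.restrict hR₁.le) 1 (fun c : EuclideanSpace ℝ (Fin 1) ↦ AFEnd.breatheFamily B (H (EuclideanSpace.single 0 ((c 0) ^ 2))) (c 0)) ∧ InitialDataSet.IsImmersedAtZero 1 (fun c : EuclideanSpace ℝ (Fin 1) ↦ AFEnd.breatheFamily B (H (EuclideanSpace.single 0 ((c 0) ^ 2))) (c 0)) :=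
  fun _ _ _ _ _ _ _ _ B H _ hR₁ hH ↦
    ⟨GaugeBorneUpgrade.isTameDataFamily_restrict_gauged B H hH hR₁,
      GaugeBorneUpgrade.isImmersedAtZero_gauged B H hH.1⟩

end Summit.FinalStateConjecture.FinalStateConjecture.Theorems.ExactKerrEnds

end
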